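import Mathlib
import Summits.Ventures.PercRepro2.TwoHullMasterPath2

/-!
# Cube sides: (MM) on every parallel composition of paths (blind cell PercRepro2, night-4 g39,
2026-08-29; proofs/NIGHT4-G39.md §7, Theorem 4)

A CUBE SIDE of dimension `ι` (`CubeSide ends l h ι orb c Q T T'`): an action `orb` of `(ℤ/2)^ι` on
the configurations with no monochromatic `l`–`h` connection, under which the hull pair of `l` at
the point `ε` is the union over `j` of the sub-pairs `Q j` (swapped where `ε j`), the hull pair of
`h` the union of `T j` / `T' j` (moved where `ε j`), each move in the direction of a colour
`c j`, and each sub-pair dominating its swap exactly when its colour is `true` (the diamond).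
THE CUBE INEQUALITY (`cube_sum_nonpos`): for `X` antitone and odd and `Y` monotone on the Boolean
cube `ι → Bool`, `Σ_ε X ε · Y ε ≤ 0` — Mathlib's FKG inequality (`fkg`) on the product lattice with
the uniform weight.  Relabelling each coordinate by its colour, the orbit sum of `Φ` is such a
sum, so (MM) holds on every cube side (**`twoHullMaster_of_cubeSide`**).  A path is a cube side of
dimension `Unit` (`cubeSide_path`, the interface involution), and the two-vertex gluing of two
cube sides is a cube side of dimension `ι₁ ⊕ ι₂` (`cubeSide_glue2`): hence (MM) holds on every
parallel composition of paths between `l` and `h` — every theta graph `Θ(k₁, …, k_r)` —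
settling the case `r ≥ 3` left open by the character expansion (NIGHT4-G39.md §7, Theorem 3),
and with the cut-vertex theorems of TwoHullMasterGlue.lean with arbitrary graphs at `l` and `h`.
-/

namespace Summit.Ventures.PercRepro2

namespace Glue2

open Hull LocRows Path2

open scoped Classical

variable {V : Type*}

/-! ## §1 The cube inequality -/

section Cube

variable {ι : Type*} [Fintype ι]

/-- The complement of a cube point. -/
def cubeNot (ε : ι → Bool) : ι → Bool := fun j => !ε j

omit [Fintype ι] in
/-- The complement is an involution. -/
lemma cubeNot_cubeNot (ε : ι → Bool) : cubeNot (cubeNot ε) = ε := by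
  funext j; simp [cubeNot]

/-- An odd function sums to zero over the cube. -/
lemma sum_eq_zero_of_odd (X : (ι → Bool) → ℤ) (hodd : ∀ ε, X (cubeNot ε) = - X ε) :
    ∑ ε, X ε = 0 := by
  have e : ∑ ε, X ε = ∑ ε, X (cubeNot ε) :=
    (Fintype.sum_equiv (Function.Involutive.toPerm cubeNot cubeNot_cubeNot) _ _ fun ε => rfl).symm
  simp_rw [hodd] at e
  rw [Finset.sum_neg_distrib] at e
  omega

/-- **The cube inequality**: an antitone odd `X` and a monotone `Y`, both bounded by `1`, have
`Σ X·Y ≤ 0` on the Boolean cube (Mathlib's FKG inequality with the uniform weight). -/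
theorem cube_sum_nonpos (X Y : (ι → Bool) → ℤ) (hX : Antitone X) (hY : Monotone Y)
    (hodd : ∀ ε, X (cubeNot ε) = - X ε) (hX1 : ∀ ε, X ε ≤ 1) (hY1 : ∀ ε, -1 ≤ Y ε) :
    ∑ ε, X ε * Y ε ≤ 0 := by
  have hz := sum_eq_zero_of_odd X hodd
  have key := fkg (α := ι → Bool) (β := ℤ) (μ := fun _ => 1) (f := fun ε => 1 - X ε)
    (g := fun ε => Y ε + 1) (fun _ => zero_le_one) (fun ε => by have := hX1 ε; simp; omega)
    (fun ε => by have := hY1 ε; simp; omega)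
    (fun a b hab => by simp only; have := hX hab; omega)
    (fun a b hab => by simp only; have := hY hab; omega)
    (fun a b => by simp)
  have expand : ∀ ε, (1 - X ε) * (Y ε + 1) = Y ε + 1 - X ε * Y ε - X ε := fun ε => by ring
  simp only [one_mul] at key
  rw [Finset.sum_congr rfl (fun ε _ => expand ε), Finset.sum_sub_distrib, Finset.sum_sub_distrib,
    Finset.sum_add_distrib, Finset.sum_sub_distrib, Finset.sum_const, Finset.card_univ, hz] at key
  simp only [nsmul_eq_mul, mul_one, Finset.sum_add_distrib, Finset.sum_const, Finset.card_univ,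
    sub_zero] at key
  have hN : (0 : ℤ) < Fintype.card (ι → Bool) := by exact_mod_cast Fintype.card_pos
  nlinarith [key, hN]

/-- The xor of two cube points. -/
def cubeXor (ε δ : ι → Bool) : ι → Bool := fun j => xor (ε j) (δ j)

omit [Fintype ι] in
/-- Xor with a fixed point is an involution. -/
lemma cubeXor_cubeXor (δ ε : ι → Bool) : cubeXor (cubeXor ε δ) δ = ε := by
  funext j; simp [cubeXor]

omit [Fintype ι] in
/-- Xor with the zero point. -/
lemma cubeXor_zero (ε : ι → Bool) : cubeXor ε (fun _ => false) = ε := by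
  funext j; simp [cubeXor]

omit [Fintype ι] in
/-- Xor with itself. -/
lemma cubeXor_self (ε : ι → Bool) : cubeXor ε ε = fun _ => false := by
  funext j; simp [cubeXor]

end Cube

/-! ## §2 Cube sides -/

/-- The union of a family of pairs, coordinatewise. -/
def unionPairs {ι : Type*} (P : ι → Set V × Set V) : Set V × Set V :=
  (⋃ j, (P j).1, ⋃ j, (P j).2)

/-- The swap of a union is the union of the swaps. -/
lemma unionPairs_swap {ι : Type*} (P : ι → Set V × Set V) :
    (unionPairs P).swap = unionPairs fun j => (P j).swap := rfl

/-- The union is monotone in the family. -/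
lemma PairLE.unionPairs {ι : Type*} {P P' : ι → Set V × Set V} (h : ∀ j, PairLE (P j) (P' j)) :
    PairLE (unionPairs P) (unionPairs P') :=
  ⟨Set.iUnion_mono fun j => (h j).1, Set.iUnion_mono fun j => (h j).2⟩

/-- The union over a sum type is the union of the two unions. -/
lemma unionPairs_sum {ι₁ ι₂ : Type*} (P : ι₁ ⊕ ι₂ → Set V × Set V) :
    unionPairs P = pairUnion (unionPairs fun j => P (Sum.inl j)) (unionPairs fun j => P (Sum.inr j)) := by
  simp only [unionPairs, pairUnion, Set.iUnion_sum]

/-- The union over `Unit`. -/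
lemma unionPairs_unit (P : Unit → Set V × Set V) : unionPairs P = P () := by
  have hP : P = fun _ => P () := funext fun j => by cases j; rfl
  rw [hP]
  simp only [unionPairs, Set.iUnion_const]

/-- **A cube side**: an action of the Boolean cube `ι → Bool` on the configurations with
`h ∉ H_l`, under which the hull pair of `l` at `ε` is the union of the sub-pairs `Q j` (swapped
where `ε j`), the hull pair of `h` the union of `T j` / `T' j` (moved where `ε j`), every move in
the direction of the colour `c j`, every sub-pair on the side of the diamond given by its colour. -/
structure CubeSide {E : Type*} (ends : E → Sym2 V) (l h : V) (ι : Type*)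
    (orb : (ι → Bool) → Config E → Config E) (c : ι → Config E → Bool)
    (Q T T' : ι → Config E → Set V × Set V) : Prop where
  orb_zero : ∀ ζ, orb (fun _ => false) ζ = ζ
  mem : ∀ ζ, h ∉ hull ends ζ l → ∀ ε, h ∉ hull ends (orb ε ζ) l
  orb_orb : ∀ ζ, h ∉ hull ends ζ l → ∀ ε ε', orb ε (orb ε' ζ) = orb (cubeXor ε ε') ζ
  l_pair : ∀ ζ, h ∉ hull ends ζ l → ∀ ε,
    hullPair ends (orb ε ζ) l = unionPairs fun j => if ε j then (Q j ζ).swap else Q j ζ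
  h_pair : ∀ ζ, h ∉ hull ends ζ l → ∀ ε,
    hullPair ends (orb ε ζ) h = unionPairs fun j => if ε j then T' j ζ else T j ζ
  up : ∀ ζ, h ∉ hull ends ζ l → ∀ j, c j ζ = true → PairLE (T j ζ) (T' j ζ)
  down : ∀ ζ, h ∉ hull ends ζ l → ∀ j, c j ζ = false → PairLE (T' j ζ) (T j ζ)
  dia_up : ∀ ζ, h ∉ hull ends ζ l → ∀ j, c j ζ = true → PairLE (Q j ζ).swap (Q j ζ)
  dia_down : ∀ ζ, h ∉ hull ends ζ l → ∀ j, c j ζ = false → PairLE (Q j ζ) (Q j ζ).swap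

/-! ## §3 (MM) on a cube side -/

section Main

variable {E : Type*} [Fintype E] [DecidableEq E] {ends : E → Sym2 V} {l h : V} {ι : Type*}
  [Fintype ι] {orb : (ι → Bool) → Config E → Config E} {c : ι → Config E → Bool}
  {Q T T' : ι → Config E → Set V × Set V}

/-- The sign is bounded by `1`. -/
lemma sgn_le_one (𝓦 : Set (Set V × Set V)) (q : Set V × Set V) : sgn 𝓦 q ≤ 1 := by
  simp only [sgn, ind]; split_ifs <;> omega

/-- The sign is bounded below by `-1`. -/
lemma neg_one_le_sgn (𝓦 : Set (Set V × Set V)) (q : Set V × Set V) : -1 ≤ sgn 𝓦 q := by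
  simp only [sgn, ind]; split_ifs <;> omega

omit [Fintype E] [DecidableEq E] in
/-- **The orbit inequality on a cube side**: the sum of `Φ` over the orbit of `ζ` is non-positive. -/
theorem orbit_sum_nonpos_cube (hs : CubeSide ends l h ι orb c Q T T')
    {𝓦l 𝓦h : Set (Set V × Set V)} (h𝓦l : IsPairUpSet 𝓦l) (h𝓦h : IsPairUpSet 𝓦h)
    {ζ : Config E} (hU : h ∉ hull ends ζ l) :
    ∑ ε, phiG ends l h 𝓦l 𝓦h (orb ε ζ) ≤ 0 := by
  -- relabel every coordinate by its colour
  set δ : ι → Bool := fun j => !c j ζ with hδ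
  have reindex : ∑ ε, phiG ends l h 𝓦l 𝓦h (orb ε ζ) =
      ∑ ε, phiG ends l h 𝓦l 𝓦h (orb (cubeXor ε δ) ζ) :=
    (Fintype.sum_equiv (Function.Involutive.toPerm (fun ε => cubeXor ε δ) (cubeXor_cubeXor δ))
      _ _ fun ε => rfl).symm
  rw [reindex]
  -- the two functions on the cube
  let X : (ι → Bool) → ℤ := fun ε => sgn 𝓦l (hullPair ends (orb (cubeXor ε δ) ζ) l)
  let Y : (ι → Bool) → ℤ := fun ε => sgn 𝓦h (hullPair ends (orb (cubeXor ε δ) ζ) h)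
  have hX : Antitone X := by
    intro ε ε' hle
    simp only [X, hs.l_pair ζ hU]
    refine sgn_mono h𝓦l (PairLE.unionPairs fun j => ?_)
    simp only [cubeXor, hδ]
    cases hc : c j ζ with
    | true =>
      have hd := hs.dia_up ζ hU j hc
      simp only [Bool.not_true, Bool.xor_false]
      rcases Bool.eq_false_or_eq_true (ε j) with h1 | h1 <;>
        rcases Bool.eq_false_or_eq_true (ε' j) with h2 | h2 <;> simp only [h1, h2, if_true]
      · exact PairLE.refl _
      · have := hle j; rw [h1, h2] at this; exact absurd this (by simp)
      · exact hd
      · exact PairLE.refl _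
    | false =>
      have hd := hs.dia_down ζ hU j hc
      simp only [Bool.not_false, Bool.xor_true]
      rcases Bool.eq_false_or_eq_true (ε j) with h1 | h1 <;>
        rcases Bool.eq_false_or_eq_true (ε' j) with h2 | h2 <;> simp only [h1, h2, Bool.not_true, Bool.not_false, if_true]
      · exact PairLE.refl _
      · have := hle j; rw [h1, h2] at this; exact absurd this (by simp)
      · exact hd
      · exact PairLE.refl _
  have hY : Monotone Y := by
    intro ε ε' hle
    simp only [Y, hs.h_pair ζ hU]
    refine sgn_mono h𝓦h (PairLE.unionPairs fun j => ?_)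
    simp only [cubeXor, hδ]
    cases hc : c j ζ with
    | true =>
      have hm := hs.up ζ hU j hc
      simp only [Bool.not_true, Bool.xor_false]
      rcases Bool.eq_false_or_eq_true (ε j) with h1 | h1 <;>
        rcases Bool.eq_false_or_eq_true (ε' j) with h2 | h2 <;> simp only [h1, h2, if_true]
      · exact PairLE.refl _
      · have := hle j; rw [h1, h2] at this; exact absurd this (by simp)
      · exact hm
      · exact PairLE.refl _
    | false =>
      have hm := hs.down ζ hU j hc
      simp only [Bool.not_false, Bool.xor_true]
      rcases Bool.eq_false_or_eq_true (ε j) with h1 | h1 <;>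
        rcases Bool.eq_false_or_eq_true (ε' j) with h2 | h2 <;> simp only [h1, h2, Bool.not_true, Bool.not_false, if_true]
      · exact PairLE.refl _
      · have := hle j; rw [h1, h2] at this; exact absurd this (by simp)
      · exact hm
      · exact PairLE.refl _
  have hodd : ∀ ε, X (cubeNot ε) = - X ε := by
    intro ε
    simp only [X, hs.l_pair ζ hU]
    rw [← sgn_swap, unionPairs_swap]
    congr 2
    funext j
    simp only [cubeNot, cubeXor]
    rcases Bool.eq_false_or_eq_true (ε j) with h1 | h1 <;>
      rcases Bool.eq_false_or_eq_true (δ j) with h2 | h2 <;> simp [h1, h2]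
  exact cube_sum_nonpos X Y hX hY hodd (fun ε => sgn_le_one _ _) (fun ε => neg_one_le_sgn _ _)

/-- **(MM) on a cube side.** -/
theorem twoHullMaster_of_cubeSide (hs : CubeSide ends l h ι orb c Q T T') :
    TwoHullMaster ends l h := by
  refine twoHullMaster_of_sum_nonpos l h fun 𝓦l 𝓦h h𝓦l h𝓦h => ?_
  set Φ := phiG ends l h 𝓦l 𝓦h with hΦ
  -- every `orb ε` is a bijection of `U`
  have hbij : ∀ ε, ∑ ζ ∈ uClass ends l h, Φ (orb ε ζ) = ∑ ζ ∈ uClass ends l h, Φ ζ := by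
    intro ε
    refine Finset.sum_nbij' (orb ε) (orb ε) ?_ ?_ ?_ ?_ ?_
    · intro ζ hζ; rw [mem_uClass] at hζ ⊢; exact hs.mem ζ hζ ε
    · intro ζ hζ; rw [mem_uClass] at hζ ⊢; exact hs.mem ζ hζ ε
    · intro ζ hζ; rw [mem_uClass] at hζ; rw [hs.orb_orb ζ hζ, cubeXor_self, hs.orb_zero]
    · intro ζ hζ; rw [mem_uClass] at hζ; rw [hs.orb_orb ζ hζ, cubeXor_self, hs.orb_zero]
    · intro ζ _; rfl
  have hN : (0 : ℤ) < Fintype.card (ι → Bool) := by exact_mod_cast Fintype.card_pos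
  have h1 : (Fintype.card (ι → Bool) : ℤ) * ∑ ζ ∈ uClass ends l h, Φ ζ =
      ∑ ζ ∈ uClass ends l h, ∑ ε, Φ (orb ε ζ) := by
    rw [Finset.sum_comm]
    simp_rw [hbij]
    simp [Finset.sum_const, Finset.card_univ]
  have h2 : ∑ ζ ∈ uClass ends l h, ∑ ε, Φ (orb ε ζ) ≤ 0 := by
    refine Finset.sum_nonpos fun ζ hζ => ?_
    rw [mem_uClass] at hζ
    exact orbit_sum_nonpos_cube hs h𝓦l h𝓦h hζ
  nlinarith

end Main

end Glue2

end Summit.Ventures.PercRepro2
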